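import Literature.Barriers.AtomisticToContinuum.DisorderedHarmonicChainLowerBoundProofs
import Literature.Barriers.AtomisticToContinuum.DisorderedHarmonicChainPointwise
import HarnessLib

/-!
# Ajanki–Huveneers 2011, §6.1: the resonant set has probability `≳ w²` — the last two displays, reduced to Prop. 5.1

Companion to `DisorderedHarmonicChainLowerBound.lean` (which vendors the named fact
`AjankiHuveneers2011_resonantSetProbability`: `P(E_n) ≥ Kw²` for `1/2 ≤ w²n ≤ 1`, `w ≤ w₀`, with the
resonant set `E_n = {|X^ϑ_n|_𝕋 ≤ w², Γ^ϑ_n ≤ R, |X^0_n|_𝕋 ≤ cw, Γ^0_n ≤ cR}`, and proves (L) from it) and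
sibling of `DisorderedHarmonicChainPointwise.lean` (the same service for the upper bound). Source:
O. Ajanki, F. Huveneers, *Rigorous scaling law for the heat current in disordered harmonic chain*,
CMP **301** (2011) 841–883, arXiv:1003.1076, §6.1, the two unnumbered displays following (6.9) and the
closing sentence "Proposition 5.1 and Lemma 6.1 allow then to conclude that `𝔼(j_n(w)) ≳ w²` if `R` is
chosen large enough."

PROVED here: `AjankiHuveneers2011_resonantSetProbability_of_potentialTheory :
AjankiHuveneers2011_potentialTheory → AjankiHuveneers2011_resonantSetProbability`, i.e. the whole printed
derivation from the inputs the tree has as theorems — Lemma 3.7 + Lemma 6.1 in the tail form (6.8)–(6.9)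
(`AjankiHuveneers2011_jointBehaviourTails_holds`), the positivity `X^ϑ_n - X^0_n > 0` of (3.25)
(`jb_theta_recursion`), the expansion (3.21) of `log Γ` (`AjankiHuveneers2011_logGammaExpansion_holds`) —
and the one input that is still a named fact, Prop. 5.1 (`AjankiHuveneers2011_potentialTheory` of
`…Phases.lean`, its own provefact unit `…Potential.lean`). Steps, as printed:

* `P(E_n) ≥ P(A ∩ {Γ^ϑ_n ≤ R} ∩ {e^{M_n} ≤ R}) - P(Exc₁) - P(Exc₂)`, `A = {|X^ϑ_n|_𝕋 ≤ w²}`, where by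
  (6.8) (`|X^0_n|_𝕋 ≤ |X^ϑ_n|_𝕋 + (X^ϑ_n - X^0_n) ≤ w² + c₀Rw`, `rs_norm_X0_le`) and (6.9)
  (`Γ^0_n ≤ c₀Γ^ϑ_n ≤ c₀R`) the exceptional events are the two tails of Lemma 6.1, each `≤ Cw³`
  (`α = 3`); `c = c₀R + 1`.
* "`≥ P(|X^ϑ_n|_𝕋 ≤ w²) - … - P(|X^ϑ_n|_𝕋 ≤ w², Γ^ϑ_n > R) - P(|X^ϑ_n|_𝕋 ≤ w², e^{M_n} > R)`. Applying
  then Markov's inequality to the two last terms, one gets `… - R⁻¹𝔼[χ_{B(0,w²)}(X^ϑ_n)Γ^ϑ_n] -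
  R⁻¹𝔼[χ_{B(0,w²)}(X^ϑ_n)e^{M_n}]`" (`mul_meas_ge_le_integral_of_nonneg`, union bound
  `rs_measureReal_le_of_ae_imp₅`).
* Prop. 5.1 three times with `u = χ_{B̄(0,w²)}` read on `ℝ` through its defining equation (`rsWin_*`
  lemmas; `∫_𝕋 u ∈ [w², 2w²]`, `sq_le_integral_rsWin`, `integral_rsWin_le`), `x = ϑ`, `κ = 1/2`: the
  lower bound with `h ≡ 0` gives
  `P(A) ≥ K'w²`; the upper bound (`wn ≥ w²n ≥ 1/2`, `1/(w√n) ≤ √2`) with `h = φ' = π sin 2π·` (the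
  exponent IS `M_n = ahMart`) gives `𝔼[u(X_n)e^{M_n}] ≤ 2√2K_{φ'}w²`, and with `h = s` together with
  `Γ_n ≤ E₀e^{w∑s(X)B}` for `w²n ≤ 1` (`rs_ahGamma_le_exp`, from (3.21)) gives `𝔼[u(X_n)Γ_n] ≤ 2√2E₀K_sw²`.
* `R = max{1, 8√2(K_{φ'} + E₀K_s)/K'}`, `w₀ ≤ K'/(8C)` and below all thresholds, `K = K'/2`.

No new named facts (D-0026): everything below is a theorem; the discharge
`AjankiHuveneers2011_resonantSetProbability_holds` follows from this file the moment
`AjankiHuveneers2011_potentialTheory` is discharged (`…_of_potentialTheory potentialTheory_holds`).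
Equation numbers are those of arXiv:1003.1076v1, as in `DisorderedHarmonicChainLowerBound.lean`.
-/

noncomputable section

open MeasureTheory Finset Real

namespace Literature.Barriers.AtomisticToContinuum.HeatConduction

/-! ### The window `u_w = χ_{B̄(0,w²)}` on `𝕋`, read as a `1`-periodic function on `ℝ` -/

/-- The closed ball `{‖y‖_𝕋 ≤ w²}` of `𝕋 = ℝ/ℤ`, read on `ℝ`, is Borel. [folklore] -/
theorem measurableSet_rsBall (w : ℝ) : MeasurableSet {y : ℝ | ‖(y : UnitAddCircle)‖ ≤ w ^ 2} := by
  have hc : Continuous fun y : ℝ => ‖(y : UnitAddCircle)‖ :=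
    continuous_norm.comp (AddCircle.continuous_mk' (1 : ℝ))
  exact measurableSet_le hc.measurable measurable_const

section Window

/-! The window `u = u_w = χ_{B̄(0,w²)} : 𝕋 → {0,1}` of the last display of §6.1 (the `u` fed to Prop. 5.1),
as a `1`-periodic function on `ℝ`: `u(y) = 1` if `‖y‖_𝕋 ≤ w²` and `0` otherwise — introduced through its
defining equation `hu`, as the cut-offs of `…Pointwise.lean`. -/

variable {w : ℝ} {u : ℝ → ℝ} (hu : ∀ y, u y = if ‖(y : UnitAddCircle)‖ ≤ w ^ 2 then 1 else 0)
include hu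

/-- `u_w ≥ 0`. [folklore] -/
theorem rsWin_nonneg (y : ℝ) : 0 ≤ u y := by
  rw [hu]; split_ifs <;> norm_num

/-- `u_w ≤ 1`. [folklore] -/
theorem rsWin_le_one (y : ℝ) : u y ≤ 1 := by
  rw [hu]; split_ifs <;> norm_num

/-- `u_w = 1` on the ball. [folklore] -/
theorem rsWin_of_le {y : ℝ} (h : ‖(y : UnitAddCircle)‖ ≤ w ^ 2) : u y = 1 := by
  rw [hu, if_pos h]

/-- `u_w` is a function on `𝕋 = ℝ/ℤ`. [cite: AjankiHuveneers2011, §2 "Periodicity"] -/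
theorem rsWin_periodic : Function.Periodic u 1 := by
  intro y
  rw [hu, hu]
  have : ((y + 1 : ℝ) : UnitAddCircle) = (y : UnitAddCircle) := by
    rw [AddCircle.coe_add, AddCircle.coe_period, add_zero]
  rw [this]

/-- `u_w` is the indicator of the ball. [folklore] -/
theorem rsWin_eq_indicator :
    u = Set.indicator {y : ℝ | ‖(y : UnitAddCircle)‖ ≤ w ^ 2} (fun _ => (1 : ℝ)) := by
  funext y
  rw [hu]
  by_cases h : ‖(y : UnitAddCircle)‖ ≤ w ^ 2
  · rw [if_pos h, Set.indicator_of_mem (by exact h)]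
  · rw [if_neg h, Set.indicator_of_notMem (by exact h)]

/-- `u_w` is Borel. [folklore] -/
theorem measurable_rsWin : Measurable u := by
  rw [rsWin_eq_indicator hu]
  exact measurable_const.indicator (measurableSet_rsBall w)

/-- `u_w ∈ L¹(𝕋)`. [folklore] -/
theorem integrableOn_rsWin : IntegrableOn u (Set.Ico 0 1) := by
  refine Measure.integrableOn_of_bounded (M := (1 : ℝ)) (by simp [Real.volume_Ico])
    (measurable_rsWin hu).aestronglyMeasurable (ae_of_all _ fun y => ?_)
  rw [Real.norm_eq_abs, abs_of_nonneg (rsWin_nonneg hu y)]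
  exact rsWin_le_one hu y

/-- `∫_𝕋 u_w = Leb([0,1) ∩ {‖y‖_𝕋 ≤ w²})`. [folklore] -/
theorem integral_rsWin_eq :
    ∫ y in Set.Ico (0 : ℝ) 1, u y =
      volume.real (Set.Ico (0 : ℝ) 1 ∩ {y : ℝ | ‖(y : UnitAddCircle)‖ ≤ w ^ 2}) := by
  rw [rsWin_eq_indicator hu, integral_indicator (measurableSet_rsBall w), Measure.restrict_restrict
    (measurableSet_rsBall w), setIntegral_const, smul_eq_mul, mul_one, Set.inter_comm]

/-- **`∫_𝕋 u_w ≥ w²`** (`[0, w²] ⊆ [0,1) ∩ {‖y‖_𝕋 ≤ w²}` for `w² < 1`; in fact `∫_𝕋 u_w = 2w²`).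
[folklore] -/
theorem sq_le_integral_rsWin (hw : w ^ 2 < 1) :
    w ^ 2 ≤ ∫ y in Set.Ico (0 : ℝ) 1, u y := by
  rw [integral_rsWin_eq hu]
  have hsub : Set.Icc (0 : ℝ) (w ^ 2) ⊆ Set.Ico (0 : ℝ) 1 ∩ {y : ℝ | ‖(y : UnitAddCircle)‖ ≤ w ^ 2} := by
    intro y hy
    refine ⟨⟨hy.1, hy.2.trans_lt hw⟩, ?_⟩
    show ‖(y : UnitAddCircle)‖ ≤ w ^ 2
    calc ‖(y : UnitAddCircle)‖ ≤ |y| := norm_coe_unitAddCircle_le_abs y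
      _ = y := abs_of_nonneg hy.1
      _ ≤ w ^ 2 := hy.2
  calc w ^ 2 = volume.real (Set.Icc (0 : ℝ) (w ^ 2)) := by
        rw [Real.volume_real_Icc_of_le (sq_nonneg w), sub_zero]
    _ ≤ _ := measureReal_mono hsub (measure_ne_top_of_subset Set.inter_subset_left
        (by simp [Real.volume_Ico]))

/-- **`∫_𝕋 u_w ≤ 2w²`** (`[0,1) ∩ {‖y‖_𝕋 ≤ w²} ⊆ [0, w²] ∪ [1 - w², 1]`). [folklore] -/
theorem integral_rsWin_le :
    ∫ y in Set.Ico (0 : ℝ) 1, u y ≤ 2 * w ^ 2 := by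
  rw [integral_rsWin_eq hu]
  have hsub : Set.Ico (0 : ℝ) 1 ∩ {y : ℝ | ‖(y : UnitAddCircle)‖ ≤ w ^ 2} ⊆
      Set.Icc (0 : ℝ) (w ^ 2) ∪ Set.Icc (1 - w ^ 2) 1 := by
    rintro y ⟨⟨hy0, hy1⟩, hy⟩
    change ‖(y : UnitAddCircle)‖ ≤ w ^ 2 at hy
    by_cases h : y ≤ 1 / 2
    · left
      have hn : ‖(y : UnitAddCircle)‖ = |y| :=
        (AddCircle.norm_coe_eq_abs_iff (1 : ℝ) one_ne_zero).2 (by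
          rw [abs_of_nonneg hy0, abs_one]; linarith)
      rw [hn, abs_of_nonneg hy0] at hy
      exact ⟨hy0, hy⟩
    · right
      have h : 1 / 2 < y := not_le.mp h
      have hcoe : ((y : ℝ) : UnitAddCircle) = ((y - 1 : ℝ) : UnitAddCircle) := by
        rw [AddCircle.coe_sub, AddCircle.coe_period, sub_zero]
      have hn : ‖((y - 1 : ℝ) : UnitAddCircle)‖ = |y - 1| :=
        (AddCircle.norm_coe_eq_abs_iff (1 : ℝ) one_ne_zero).2 (by
          rw [abs_of_nonpos (by linarith), abs_one]; linarith)
      rw [hcoe, hn, abs_of_nonpos (by linarith)] at hy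
      exact ⟨by linarith, hy1.le⟩
  calc volume.real (Set.Ico (0 : ℝ) 1 ∩ {y : ℝ | ‖(y : UnitAddCircle)‖ ≤ w ^ 2})
      ≤ volume.real (Set.Icc (0 : ℝ) (w ^ 2) ∪ Set.Icc (1 - w ^ 2) 1) :=
        measureReal_mono hsub
          (ne_top_of_le_ne_top (by simp [Real.volume_Icc]) (measure_union_le _ _))
    _ ≤ volume.real (Set.Icc (0 : ℝ) (w ^ 2)) + volume.real (Set.Icc (1 - w ^ 2) 1) :=
        measureReal_union_le _ _
    _ = 2 * w ^ 2 := by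
        rw [Real.volume_real_Icc_of_le (sq_nonneg w), Real.volume_real_Icc_of_le (by nlinarith [sq_nonneg w])]
        ring

end Window

/-! ### The pointwise inclusion behind (6.8) -/

/-- **(6.8) pointwise**: `‖X^0_n‖_𝕋 ≤ ‖X^ϑ_n‖_𝕋 + |X^ϑ_n - X^0_n| ≤ w² + c₀Rw ≤ (c₀R + 1)w` — "by
(3.25), one has `χ_{B(cw)}(X^0_n) ≥ χ_{[0,R]}(e^{M_n}) χ_{B(0,1)}(L_n) χ_{B(0,w²)}(X^ϑ_n)` provided `c`
is large enough". [cite: AjankiHuveneers2011, §6.1 eq. (6.8)] -/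
theorem rs_norm_X0_le {Xθ X0 w c₀ R : ℝ} (hw0 : 0 ≤ w) (hw1 : w ≤ 1)
    (hX : ‖(Xθ : UnitAddCircle)‖ ≤ w ^ 2) (hd0 : 0 ≤ Xθ - X0) (hd : Xθ - X0 ≤ c₀ * R * w) :
    ‖(X0 : UnitAddCircle)‖ ≤ (c₀ * R + 1) * w := by
  have h := norm_coe_unitAddCircle_sub_le Xθ (Xθ - X0)
  rw [show Xθ - (Xθ - X0) = X0 by ring, abs_of_nonneg hd0] at h
  have hw2 : w ^ 2 ≤ w := by nlinarith
  linarith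

/-! ### `s = -(π/2) sin 2π·` is a `C¹` function on `𝕋` with `|s| ≤ π/2` -/

/-- `s` is `1`-periodic. [folklore] -/
theorem periodic_ahS : Function.Periodic ahS 1 := fun y => by
  unfold ahS
  rw [show 2 * π * (y + 1) = 2 * π * y + 2 * π by ring, Real.sin_add_two_pi]

/-- `s ∈ C¹`. [folklore] -/
theorem contDiff_ahS : ContDiff ℝ 1 ahS := by
  unfold ahS; fun_prop

/-- `|s| ≤ π/2`. [folklore] -/
theorem abs_ahS_le (x : ℝ) : |ahS x| ≤ π / 2 := by
  unfold ahS
  rw [abs_mul, abs_neg, abs_of_pos (by positivity : (0 : ℝ) < π / 2)]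
  exact mul_le_of_le_one_right (by positivity) (Real.abs_sin_le_one _)

/-! ### `Γ_m ≤ E₀ e^{w ∑_{k<m} s(X_k) B_{k+1}}` for `w²m ≤ 1`, from (3.21) -/

/-- **`Γ^x_m ≤ E₀ e^{w∑_{k<m} s(X^x_k)B_{k+1}}` for `w²m ≤ 1`**: from (3.21),
`log Γ^x_m ≤ ∑_{l=1}^{m-1}(w s(X_l)B_{l+1} + w²r(X_l)B_{l+1}²) + Cw³m` with `w²∑|r|B² ≤ (π²/2)b_*²`,
`Cw³m ≤ C` (`w²m ≤ 1`, `w ≤ 1`) and the `k = 0` term `w s(x)B_1` costing at most `(π/2)b_*` — the step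
"`Γ_n ≲ e^{w∑ s(X)B}`" implicit in the application of Prop. 5.1 (upper bound, `h = s`) to the term
`R⁻¹𝔼[χ_{B(0,w²)}(X^ϑ_n)Γ^ϑ_n]` of the last display of §6.1.
[cite: AjankiHuveneers2011, §6.1 (last display) with Prop. 3.5 eq. (3.21)] -/
theorem rs_ahGamma_le_exp (bm bp : ℝ) (hbm : -1 < bm) (hlt : bm < bp) :
    ∃ w₀ : ℝ, 0 < w₀ ∧ ∃ E₀ : ℝ, 1 ≤ E₀ ∧ ∀ w ∈ Set.Ioc 0 w₀, ∀ x : ℝ, ∀ B : ℕ → ℝ,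
      (∀ k, B k ∈ Set.Icc bm bp) → ∀ m : ℕ, w ^ 2 * m ≤ 1 →
        0 < ahGamma w x B m ∧
          ahGamma w x B m ≤ E₀ * Real.exp (w * ∑ k ∈ Finset.range m, ahS (ahPhase w x B k) * B k) := by
  obtain ⟨w₄, hw₄, C₄, hC⟩ := AjankiHuveneers2011_logGammaExpansion_holds bm bp hbm hlt
  obtain ⟨M, hM⟩ : ∃ M : ℝ, M = max |bm| |bp| := ⟨_, rfl⟩
  have hM0 : 0 ≤ M := hM ▸ le_max_of_le_left (abs_nonneg _)
  set c₀ : ℝ := π / 2 * M + π ^ 2 / 2 * M ^ 2 + |C₄| with hc₀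
  have hc₀0 : 0 ≤ c₀ := by positivity
  refine ⟨min w₄ 1, by positivity, Real.exp c₀, Real.one_le_exp hc₀0, ?_⟩
  intro w hw x B hB m hm
  have hw0 : 0 < w := hw.1
  have hw4 : w ∈ Set.Ioc 0 w₄ := ⟨hw0, hw.2.trans (min_le_left _ _)⟩
  have hw1 : w ≤ 1 := hw.2.trans (min_le_right _ _)
  obtain ⟨hpos, hlog⟩ := hC w hw4 x B hB m
  refine ⟨hpos, ?_⟩
  rw [← Real.exp_add, ← Real.exp_log hpos, Real.exp_le_exp]
  have hBabs : ∀ k, |B k| ≤ M := fun k => hM ▸ abs_le_max_abs_abs (hB k).1 (hB k).2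
  have hBsq : ∀ k, B k ^ 2 ≤ M ^ 2 := fun k => by
    rw [← sq_abs]; exact pow_le_pow_left₀ (abs_nonneg _) (hBabs k) 2
  set T := ∑ l ∈ Finset.Ico 1 m,
    (w * ahS (ahPhase w x B l) * B l + w ^ 2 * ahR (ahPhase w x B l) * B l ^ 2) with hT
  have hlog' : Real.log (ahGamma w x B m) ≤ T + |C₄| := by
    have h1 := (abs_le.mp hlog).2
    have h2 : C₄ * w ^ 3 * m ≤ |C₄| := by
      have hwm0 : 0 ≤ w ^ 3 * (m : ℝ) := by positivity
      calc C₄ * w ^ 3 * m = C₄ * (w ^ 3 * m) := by ring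
        _ ≤ |C₄| * (w ^ 3 * m) := mul_le_mul_of_nonneg_right (le_abs_self C₄) hwm0
        _ = |C₄| * w * (w ^ 2 * m) := by ring
        _ ≤ |C₄| * w * 1 := mul_le_mul_of_nonneg_left hm (mul_nonneg (abs_nonneg _) hw0.le)
        _ ≤ |C₄| * 1 * 1 := by
            refine mul_le_mul_of_nonneg_right ?_ zero_le_one
            exact mul_le_mul_of_nonneg_left hw1 (abs_nonneg _)
        _ = |C₄| := by ring
    linarith
  have hTsplit : T = w * ∑ l ∈ Finset.Ico 1 m, ahS (ahPhase w x B l) * B l +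
      ∑ l ∈ Finset.Ico 1 m, w ^ 2 * ahR (ahPhase w x B l) * B l ^ 2 := by
    rw [hT, Finset.mul_sum, ← Finset.sum_add_distrib]
    refine Finset.sum_congr rfl fun l _ => ?_
    ring
  have hRsum : ∑ l ∈ Finset.Ico 1 m, w ^ 2 * ahR (ahPhase w x B l) * B l ^ 2 ≤ π ^ 2 / 2 * M ^ 2 := by
    calc ∑ l ∈ Finset.Ico 1 m, w ^ 2 * ahR (ahPhase w x B l) * B l ^ 2
        ≤ ∑ _l ∈ Finset.Ico 1 m, w ^ 2 * (π ^ 2 / 2 * M ^ 2) := by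
          refine Finset.sum_le_sum fun l _ => ?_
          have hr := abs_le.mp (abs_ahR_le (ahPhase w x B l))
          have hb := hBsq l
          have hb0 : 0 ≤ B l ^ 2 := sq_nonneg _
          rw [mul_assoc]
          refine mul_le_mul_of_nonneg_left ?_ (sq_nonneg w)
          calc ahR (ahPhase w x B l) * B l ^ 2 ≤ π ^ 2 / 2 * B l ^ 2 :=
                mul_le_mul_of_nonneg_right hr.2 hb0
            _ ≤ π ^ 2 / 2 * M ^ 2 := mul_le_mul_of_nonneg_left hb (by positivity)
      _ = (m - 1 : ℕ) * (w ^ 2 * (π ^ 2 / 2 * M ^ 2)) := by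
          rw [Finset.sum_const, Nat.card_Ico, nsmul_eq_mul]
      _ ≤ m * (w ^ 2 * (π ^ 2 / 2 * M ^ 2)) := by
          gcongr
          exact Nat.sub_le m 1
      _ = (w ^ 2 * m) * (π ^ 2 / 2 * M ^ 2) := by ring
      _ ≤ 1 * (π ^ 2 / 2 * M ^ 2) := mul_le_mul_of_nonneg_right hm (by positivity)
      _ = π ^ 2 / 2 * M ^ 2 := one_mul _
  have hSsum : w * ∑ l ∈ Finset.Ico 1 m, ahS (ahPhase w x B l) * B l ≤
      w * ∑ k ∈ Finset.range m, ahS (ahPhase w x B k) * B k + π / 2 * M := by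
    rcases Nat.eq_zero_or_pos m with hm0 | hmpos
    · subst hm0
      simp only [show Finset.Ico 1 0 = ∅ from Finset.Ico_eq_empty_of_le (by norm_num),
        Finset.sum_empty, mul_zero, Finset.range_zero, zero_add]
      positivity
    · rw [Finset.range_eq_Ico, Finset.sum_eq_sum_Ico_succ_bot hmpos]
      have h0 : -(w * (ahS (ahPhase w x B 0) * B 0)) ≤ π / 2 * M := by
        set t := ahS (ahPhase w x B 0) * B 0 with ht
        have h1 : |t| ≤ π / 2 * M := by
          rw [ht, abs_mul]
          exact mul_le_mul (abs_ahS_le _) (hBabs 0) (abs_nonneg _) (by positivity)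
        calc -(w * t) = w * (-t) := by ring
          _ ≤ w * |t| := mul_le_mul_of_nonneg_left (neg_le_abs t) hw0.le
          _ ≤ 1 * |t| := mul_le_mul_of_nonneg_right hw1 (abs_nonneg t)
          _ ≤ π / 2 * M := by rw [one_mul]; exact h1
      rw [mul_add]
      linarith
  calc Real.log (ahGamma w x B m) ≤ T + |C₄| := hlog'
    _ = w * ∑ l ∈ Finset.Ico 1 m, ahS (ahPhase w x B l) * B l +
          ∑ l ∈ Finset.Ico 1 m, w ^ 2 * ahR (ahPhase w x B l) * B l ^ 2 + |C₄| := by rw [hTsplit]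
    _ ≤ (w * ∑ k ∈ Finset.range m, ahS (ahPhase w x B k) * B k + π / 2 * M) +
          π ^ 2 / 2 * M ^ 2 + |C₄| := by linarith
    _ = c₀ + w * ∑ k ∈ Finset.range m, ahS (ahPhase w x B k) * B k := by
        rw [hc₀]; ring

/-! ### Measure bookkeeping -/

/-- Union bound from an a.e. pointwise implication with five alternatives. [folklore] -/
theorem rs_measureReal_le_of_ae_imp₅ {Ω : Type*} [MeasurableSpace Ω] (μ : Measure Ω) [IsFiniteMeasure μ]
    {S T₁ T₂ T₃ T₄ T₅ : Set Ω}
    (h : ∀ᵐ ω ∂μ, ω ∈ S → ω ∈ T₁ ∨ ω ∈ T₂ ∨ ω ∈ T₃ ∨ ω ∈ T₄ ∨ ω ∈ T₅) :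
    μ.real S ≤ μ.real T₁ + μ.real T₂ + μ.real T₃ + μ.real T₄ + μ.real T₅ := by
  have hincl : S ≤ᵐ[μ] (T₁ ∪ T₂ ∪ T₃ ∪ T₄ ∪ T₅ : Set Ω) := by
    refine h.mono fun ω hω hS => ?_
    rcases hω hS with h | h | h | h | h
    · exact Or.inl (Or.inl (Or.inl (Or.inl h)))
    · exact Or.inl (Or.inl (Or.inl (Or.inr h)))
    · exact Or.inl (Or.inl (Or.inr h))
    · exact Or.inl (Or.inr h)
    · exact Or.inr h
  have h1 : μ S ≤ μ T₁ + μ T₂ + μ T₃ + μ T₄ + μ T₅ :=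
    calc μ S ≤ μ (T₁ ∪ T₂ ∪ T₃ ∪ T₄ ∪ T₅) := measure_mono_ae hincl
      _ ≤ μ (T₁ ∪ T₂ ∪ T₃ ∪ T₄) + μ T₅ := measure_union_le _ _
      _ ≤ μ (T₁ ∪ T₂ ∪ T₃) + μ T₄ + μ T₅ := by gcongr; exact measure_union_le _ _
      _ ≤ μ (T₁ ∪ T₂) + μ T₃ + μ T₄ + μ T₅ := by gcongr; exact measure_union_le _ _
      _ ≤ μ T₁ + μ T₂ + μ T₃ + μ T₄ + μ T₅ := by gcongr; exact measure_union_le _ _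
  simp only [measureReal_def]
  rw [← ENNReal.toReal_add (measure_ne_top _ _) (measure_ne_top _ _),
    ← ENNReal.toReal_add (by finiteness) (measure_ne_top _ _),
    ← ENNReal.toReal_add (by finiteness) (measure_ne_top _ _),
    ← ENNReal.toReal_add (by finiteness) (measure_ne_top _ _)]
  exact ENNReal.toReal_mono (by finiteness) h1

/-- `1/(w√n) ≤ √2` on the band `w²n ≥ 1/2`. [folklore] -/
theorem rs_one_div_mul_sqrt_le {w : ℝ} {n : ℕ} (hw0 : 0 < w) (hn : (0 : ℝ) < n) (hband : 1 / 2 ≤ w ^ 2 * n) :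
    1 / (w * Real.sqrt n) ≤ Real.sqrt 2 := by
  have h1 : Real.sqrt (1 / 2) ≤ w * Real.sqrt n := by
    rw [show w * Real.sqrt n = Real.sqrt (w ^ 2 * n) by
      rw [Real.sqrt_mul (sq_nonneg _), Real.sqrt_sq hw0.le]]
    exact Real.sqrt_le_sqrt hband
  have hsn : 0 < Real.sqrt n := Real.sqrt_pos.mpr hn
  rw [div_le_iff₀ (by positivity)]
  calc (1 : ℝ) = Real.sqrt 2 * Real.sqrt (1 / 2) := by
        rw [← Real.sqrt_mul (by norm_num)]; norm_num
    _ ≤ Real.sqrt 2 * (w * Real.sqrt n) := mul_le_mul_of_nonneg_left h1 (Real.sqrt_nonneg _)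

end Literature.Barriers.AtomisticToContinuum.HeatConduction

namespace Literature.Barriers.AtomisticToContinuum

open Literature.MathematicalPhysics.KineticTheory.HeatConduction HeatConduction

/-- **The last two displays of §6.1, PROVED from their inputs**: Prop. 5.1 (`h5`), Lemma 3.7 with
Lemma 6.1 in the tail form (6.8)–(6.9) (`hJ`) and the positivity `X^ϑ_n - X^0_n > 0` of (3.25) (`hpos`)
imply `P(E_n) ≥ Kw²` on the band `1/2 ≤ w²n ≤ 1`:
"`P(E_n) ≥ P(|X^ϑ_n|_𝕋 ≤ w², Γ^ϑ_n ≤ R, e^{M_n} ≤ R, |L_n| ≤ 1, |K_n| ≤ 1) ≥ P(|X^ϑ_n|_𝕋 ≤ w²) -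
P(|L_n| > 1) - P(|K_n| > 1) - P(|X^ϑ_n|_𝕋 ≤ w², Γ^ϑ_n > R) - P(|X^ϑ_n|_𝕋 ≤ w², e^{M_n} > R)`.
Applying then Markov's inequality to the two last terms, one gets `… - R⁻¹𝔼[χ_{B(0,w²)}(X^ϑ_n)Γ^ϑ_n] -
R⁻¹𝔼[χ_{B(0,w²)}(X^ϑ_n)e^{M_n}]`. Proposition 5.1 and Lemma 6.1 allow then to conclude … if `R` is
chosen large enough": Prop. 5.1 is used three times with `u = χ_{B̄(0,w²)}` (`∫_𝕋 u ∈ [w², 2w²]`), `x = ϑ`: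
lower bound with `h ≡ 0` (`P(|X^ϑ_n|_𝕋 ≤ w²) ≥ K'w²`), upper bound with `h = φ'` (`𝔼[u(X_n)e^{M_n}] ≤
2√2Kw²`) and with `h = s` (`Γ_n ≤ E₀e^{w∑s(X)B}`, `rs_ahGamma_le_exp`); the tails cost `2Cw³`;
`R = max{1, 8√2(K_φ' + E₀K_s)/K'}`, `c = c₀R + 1`, `K = K'/2`.
[cite: AjankiHuveneers2011, §6.1, the two displays following (6.9), with Prop. 5.1 and Lemma 6.1] -/
theorem AjankiHuveneers2011_resonantSetProbability_of_inputs (h5 : AjankiHuveneers2011_potentialTheory)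
    (hJ : AjankiHuveneers2011_jointBehaviourTails)
    (hpos : ∀ bm bp : ℝ, ∃ w₀ : ℝ, 0 < w₀ ∧ ∀ w ∈ Set.Ioc 0 w₀, ∀ B : ℕ → ℝ,
      (∀ k, B k ∈ Set.Icc bm bp) → ∀ n, 0 < ahPhase w (ahTheta w) B n - ahPhase w 0 B n) :
    AjankiHuveneers2011_resonantSetProbability := by
  intro τ bm bp hτ ρB _ hρ
  have hκ : (0 : ℝ) < 1 / 2 := by norm_num
  -- Prop. 5.1 three times (κ = 1/2): `h ≡ 0` (lower bound), `h = φ'` (for `e^{M_n}`), `h = s` (for `Γ_n`)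
  obtain ⟨K₀, K₀', w₀, hK₀, hK₀', hw₀, h50⟩ :=
    h5 τ bm bp hτ ρB hρ (1 / 2) hκ (fun _ => 0) (fun _ => rfl) contDiff_const
  obtain ⟨K₁, K₁', w₁, hK₁, -, hw₁, h51⟩ :=
    h5 τ bm bp hτ ρB hρ (1 / 2) hκ (fun y : ℝ => π * Real.sin (2 * π * y)) periodic_pi_mul_sin
      contDiff_pi_mul_sin
  obtain ⟨K₂, K₂', w₂, hK₂, -, hw₂, h52⟩ :=
    h5 τ bm bp hτ ρB hρ (1 / 2) hκ ahS periodic_ahS contDiff_ahS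
  -- (3.21): `Γ ≤ E₀ e^{w ∑ s(X)B}`
  obtain ⟨w₃, hw₃, E₀, hE₀, hE⟩ := rs_ahGamma_le_exp bm bp hτ.lo hτ.lt
  -- Lemma 3.7 + Lemma 6.1 with `α = 3`
  obtain ⟨C, c₀, w₄, hC, hc₀, hw₄, hJ'⟩ := hJ τ bm bp hτ ρB hρ 3 (by norm_num)
  -- `d_n = X^ϑ_n - X^0_n > 0`
  obtain ⟨w₅, hw₅, hΘ⟩ := hpos bm bp
  -- constants
  have hE₀0 : 0 ≤ E₀ := zero_le_one.trans hE₀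
  set L : ℝ := 2 * Real.sqrt 2 * (K₁ + E₀ * K₂) with hL
  have hL0 : 0 ≤ L := by positivity
  set R : ℝ := max 1 (4 * L / K₀') with hR
  have hR1 : 1 ≤ R := le_max_left _ _
  have hR0 : 0 < R := by positivity
  have hRL : 4 * L / K₀' ≤ R := le_max_right _ _
  set w₆ : ℝ := K₀' / (8 * C) with hw₆
  have hw₆0 : 0 < w₆ := by positivity
  set ws : ℝ := min (min (min (min w₀ w₁) (min w₂ w₃)) (min (min w₄ w₅) w₆)) (1 / 2) with hws
  refine ⟨R, c₀ * R + 1, K₀' / 2, ws, by positivity, by positivity, ?_⟩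
  intro w hw n hn1 hn2
  obtain ⟨hw0, hwle⟩ := hw
  have hA₁ : ws ≤ min (min w₀ w₁) (min w₂ w₃) := (min_le_left _ _).trans (min_le_left _ _)
  have hA₂ : ws ≤ min (min w₄ w₅) w₆ := (min_le_left _ _).trans (min_le_right _ _)
  have hww₀ : w ∈ Set.Ioc 0 w₀ := ⟨hw0, hwle.trans (hA₁.trans ((min_le_left _ _).trans (min_le_left _ _)))⟩
  have hww₁ : w ∈ Set.Ioc 0 w₁ := ⟨hw0, hwle.trans (hA₁.trans ((min_le_left _ _).trans (min_le_right _ _)))⟩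
  have hww₂ : w ∈ Set.Ioc 0 w₂ := ⟨hw0, hwle.trans (hA₁.trans ((min_le_right _ _).trans (min_le_left _ _)))⟩
  have hww₃ : w ∈ Set.Ioc 0 w₃ := ⟨hw0, hwle.trans (hA₁.trans ((min_le_right _ _).trans (min_le_right _ _)))⟩
  have hww₄ : w ∈ Set.Ioc 0 w₄ := ⟨hw0, hwle.trans (hA₂.trans ((min_le_left _ _).trans (min_le_left _ _)))⟩
  have hww₅ : w ∈ Set.Ioc 0 w₅ := ⟨hw0, hwle.trans (hA₂.trans ((min_le_left _ _).trans (min_le_right _ _)))⟩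
  have hww₆ : w ≤ w₆ := hwle.trans (hA₂.trans (min_le_right _ _))
  have hw12 : w ≤ 1 / 2 := hwle.trans (min_le_right _ _)
  have hw1 : w ≤ 1 := by linarith
  have hwsq : w ^ 2 < 1 := by nlinarith
  -- `n ≥ 1`, `κ ≤ wn`, `1/(w√n) ≤ √2`
  have hn : 1 ≤ n := by
    rcases Nat.eq_zero_or_pos n with h | h
    · subst h; norm_num at hn1
    · exact h
  have hn0 : (0 : ℝ) < n := by exact_mod_cast hn
  have hκn : 1 / 2 ≤ w * n := by
    calc (1 : ℝ) / 2 ≤ w ^ 2 * n := hn1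
      _ = w * (w * n) := by ring
      _ ≤ 1 * (w * n) := mul_le_mul_of_nonneg_right hw1 (by positivity)
      _ = w * n := one_mul _
  have hwsn : 1 / (w * Real.sqrt n) ≤ Real.sqrt 2 := rs_one_div_mul_sqrt_le hw0 hn0 hn1
  -- the window `u = χ_{B̄(0,w²)}` on `𝕋`
  set u : ℝ → ℝ := fun y => if ‖(y : UnitAddCircle)‖ ≤ w ^ 2 then 1 else 0 with hudef
  have hu : ∀ y, u y = if ‖(y : UnitAddCircle)‖ ≤ w ^ 2 then 1 else 0 := fun y => rfl
  have hwsn' : ∀ {K : ℝ}, 0 ≤ K → K / (w * Real.sqrt n) * ∫ y in Set.Ico (0 : ℝ) 1, u y ≤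
      K * Real.sqrt 2 * (2 * w ^ 2) := by
    intro K hK
    have hI0 : 0 ≤ ∫ y in Set.Ico (0 : ℝ) 1, u y :=
      setIntegral_nonneg measurableSet_Ico fun y _ => rsWin_nonneg hu y
    calc K / (w * Real.sqrt n) * ∫ y in Set.Ico (0 : ℝ) 1, u y
        = K * (1 / (w * Real.sqrt n)) * ∫ y in Set.Ico (0 : ℝ) 1, u y := by ring
      _ ≤ K * Real.sqrt 2 * (2 * w ^ 2) :=
          mul_le_mul (mul_le_mul_of_nonneg_left hwsn hK) (integral_rsWin_le hu) hI0 (by positivity)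
  -- the probability space and the events
  set μ : Measure (Fin n → ℝ) := Measure.pi fun _ : Fin n => ρB with hμ
  set A : Set (Fin n → ℝ) :=
    {B | ‖(ahPhase w (ahTheta w) (finExt B) n : UnitAddCircle)‖ ≤ w ^ 2} with hAdef
  set E : Set (Fin n → ℝ) :=
    {B | ‖(ahPhase w (ahTheta w) (finExt B) n : UnitAddCircle)‖ ≤ w ^ 2 ∧
      ahGamma w (ahTheta w) (finExt B) n ≤ R ∧
      ‖(ahPhase w 0 (finExt B) n : UnitAddCircle)‖ ≤ (c₀ * R + 1) * w ∧
      ahGamma w 0 (finExt B) n ≤ (c₀ * R + 1) * R} with hEdef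
  set fΓ : (Fin n → ℝ) → ℝ := fun B =>
    u (ahPhase w (ahTheta w) (finExt B) n) * |ahGamma w (ahTheta w) (finExt B) n| with hfΓ
  set fM : (Fin n → ℝ) → ℝ := fun B =>
    Real.exp (w * ∑ k ∈ Finset.range n,
      (fun y : ℝ => π * Real.sin (2 * π * y)) (ahPhase w (ahTheta w) (finExt B) k) * finExt B k) *
      u (ahPhase w (ahTheta w) (finExt B) n) with hfM
  set G₂ : (Fin n → ℝ) → ℝ := fun B =>
    Real.exp (w * ∑ k ∈ Finset.range n, ahS (ahPhase w (ahTheta w) (finExt B) k) * finExt B k) *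
      u (ahPhase w (ahTheta w) (finExt B) n) with hG₂
  set SΓ : Set (Fin n → ℝ) := {B | R ≤ fΓ B} with hSΓ
  set SM : Set (Fin n → ℝ) := {B | R ≤ fM B} with hSM
  set Exc₁ : Set (Fin n → ℝ) :=
    {B | Real.exp (ahMart w (finExt B) n) ≤ R ∧
      c₀ * R * w < ahPhase w (ahTheta w) (finExt B) n - ahPhase w 0 (finExt B) n} with hExc₁
  set Exc₂ : Set (Fin n → ℝ) :=
    {B | c₀ * ahGamma w (ahTheta w) (finExt B) n < ahGamma w 0 (finExt B) n} with hExc₂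
  have hMart : ∀ B : Fin n → ℝ, w * ∑ k ∈ Finset.range n,
      (fun y : ℝ => π * Real.sin (2 * π * y)) (ahPhase w (ahTheta w) (finExt B) k) * finExt B k =
      ahMart w (finExt B) n := fun B => rfl
  -- Prop. 5.1: the three expectations
  obtain ⟨-, hB₀⟩ := (h50 w hww₀ u (rsWin_periodic hu) (rsWin_nonneg hu) (integrableOn_rsWin hu)
    (ahTheta w) n).2 hn1 hn2
  obtain ⟨hI₁, hB₁⟩ := (h51 w hww₁ u (rsWin_periodic hu) (rsWin_nonneg hu) (integrableOn_rsWin hu)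
    (ahTheta w) n).1 hκn hn2
  obtain ⟨hI₂, hB₂⟩ := (h52 w hww₂ u (rsWin_periodic hu) (rsWin_nonneg hu) (integrableOn_rsWin hu)
    (ahTheta w) n).1 hκn hn2
  -- (i) `P(A) ≥ K₀' w²`
  have hA_meas : MeasurableSet A :=
    (measurable_ahPhase_pi w (ahTheta w) n) (measurableSet_rsBall w)
  have hPA : K₀' * w ^ 2 ≤ μ.real A := by
    have h1 : (fun B : Fin n → ℝ => Real.exp (w * ∑ k ∈ Finset.range n,
        (fun _ : ℝ => (0 : ℝ)) (ahPhase w (ahTheta w) (finExt B) k) * finExt B k) *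
        u (ahPhase w (ahTheta w) (finExt B) n)) =
        fun B => A.indicator 1 B := by
      funext B
      simp only [zero_mul, Finset.sum_const_zero, mul_zero, Real.exp_zero, one_mul]
      rw [rsWin_eq_indicator hu]
      rfl
    rw [h1, integral_indicator_one hA_meas] at hB₀
    calc K₀' * w ^ 2 ≤ K₀' * ∫ y in Set.Ico (0 : ℝ) 1, u y :=
          mul_le_mul_of_nonneg_left (sq_le_integral_rsWin hu hwsq) hK₀'.le
      _ ≤ μ.real A := hB₀
  -- (ii) Markov for `Γ`: `R P(A ∩ {Γ > R}) ≤ 𝔼[u(X_n)Γ_n] ≤ E₀ 𝔼[u(X_n)e^{w∑sB}] ≤ 2√2 E₀K₂ w²`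
  have hfΓ_meas : Measurable fΓ :=
    ((measurable_rsWin hu).comp (measurable_ahPhase_pi w (ahTheta w) n)).mul
      (continuous_abs.measurable.comp (ig_measurable_ahGamma w (ahTheta w) n n))
  have hfΓ_le : ∀ᵐ B ∂μ, fΓ B ≤ E₀ * G₂ B := by
    filter_upwards [ae_pi_mem_Icc hτ.eq_zero hρ n] with β hβ
    have hBk : ∀ k, finExt β k ∈ Set.Icc bm bp := finExt_mem_Icc hτ.bm_nonpos hτ.bp_nonneg hβ
    obtain ⟨hΓpos, hΓ⟩ := hE w hww₃ (ahTheta w) (finExt β) hBk n hn2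
    have hu0 := rsWin_nonneg hu (ahPhase w (ahTheta w) (finExt β) n)
    show u (ahPhase w (ahTheta w) (finExt β) n) * |ahGamma w (ahTheta w) (finExt β) n| ≤
      E₀ * (Real.exp (w * ∑ k ∈ Finset.range n, ahS (ahPhase w (ahTheta w) (finExt β) k) * finExt β k) *
        u (ahPhase w (ahTheta w) (finExt β) n))
    rw [abs_of_pos hΓpos]
    calc u (ahPhase w (ahTheta w) (finExt β) n) * ahGamma w (ahTheta w) (finExt β) n
        ≤ u (ahPhase w (ahTheta w) (finExt β) n) *
            (E₀ * Real.exp (w * ∑ k ∈ Finset.range n, ahS (ahPhase w (ahTheta w) (finExt β) k) * finExt β k)) :=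
          mul_le_mul_of_nonneg_left hΓ hu0
      _ = _ := by ring
  have hfΓ_nonneg : ∀ B, 0 ≤ fΓ B := fun B => mul_nonneg (rsWin_nonneg hu _) (abs_nonneg _)
  have hfΓ_int : Integrable fΓ μ := by
    refine Integrable.mono' (hI₂.const_mul E₀) hfΓ_meas.aestronglyMeasurable ?_
    filter_upwards [hfΓ_le] with B hB
    rw [Real.norm_eq_abs, abs_of_nonneg (hfΓ_nonneg B)]
    exact hB
  have hPΓ : μ.real SΓ ≤ E₀ * K₂ * Real.sqrt 2 * (2 * w ^ 2) / R := by
    have hMk := mul_meas_ge_le_integral_of_nonneg (μ := μ) (ae_of_all _ hfΓ_nonneg) hfΓ_int R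
    rw [le_div_iff₀ hR0, mul_comm]
    calc R * μ.real SΓ ≤ ∫ B, fΓ B ∂μ := hMk
      _ ≤ ∫ B, E₀ * G₂ B ∂μ := integral_mono_ae hfΓ_int (hI₂.const_mul E₀) hfΓ_le
      _ = E₀ * ∫ B, G₂ B ∂μ := integral_const_mul _ _
      _ ≤ E₀ * (K₂ / (w * Real.sqrt n) * ∫ y in Set.Ico (0 : ℝ) 1, u y) :=
          mul_le_mul_of_nonneg_left hB₂ hE₀0
      _ ≤ E₀ * (K₂ * Real.sqrt 2 * (2 * w ^ 2)) := mul_le_mul_of_nonneg_left (hwsn' hK₂.le) hE₀0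
      _ = E₀ * K₂ * Real.sqrt 2 * (2 * w ^ 2) := by ring
  -- (iii) Markov for `e^{M_n}`: `R P(A ∩ {e^M > R}) ≤ 𝔼[u(X_n)e^{M_n}] ≤ 2√2 K₁ w²`
  have hfM_nonneg : ∀ B, 0 ≤ fM B := fun B => mul_nonneg (Real.exp_pos _).le (rsWin_nonneg hu _)
  have hPM : μ.real SM ≤ K₁ * Real.sqrt 2 * (2 * w ^ 2) / R := by
    have hMk := mul_meas_ge_le_integral_of_nonneg (μ := μ) (ae_of_all _ hfM_nonneg) hI₁ R
    rw [le_div_iff₀ hR0, mul_comm]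
    calc R * μ.real SM ≤ ∫ B, fM B ∂μ := hMk
      _ ≤ K₁ / (w * Real.sqrt n) * ∫ y in Set.Ico (0 : ℝ) 1, u y := hB₁
      _ ≤ K₁ * Real.sqrt 2 * (2 * w ^ 2) := hwsn' hK₁.le
  -- (iv) the tails of Lemma 6.1
  obtain ⟨hJ₁, hJ₂⟩ := hJ' w hww₄ n hn hn2
  have hw3 : w ^ (3 : ℝ) = w ^ (3 : ℕ) := by exact_mod_cast Real.rpow_natCast w 3
  have hCw : C * w ^ (3 : ℝ) ≤ K₀' / 8 * w ^ 2 := by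
    rw [hw3]
    have h1 : C * w ≤ K₀' / 8 := by
      calc C * w ≤ C * w₆ := mul_le_mul_of_nonneg_left hww₆ hC.le
        _ = K₀' / 8 := by rw [hw₆]; field_simp
    calc C * w ^ 3 = C * w * w ^ 2 := by ring
      _ ≤ K₀' / 8 * w ^ 2 := mul_le_mul_of_nonneg_right h1 (sq_nonneg w)
  have hP₁ : μ.real Exc₁ ≤ K₀' / 8 * w ^ 2 := (hJ₁ R).trans hCw
  have hP₂ : μ.real Exc₂ ≤ K₀' / 8 * w ^ 2 := hJ₂.trans hCw
  -- (v) the inclusion `A ⊆ E ∪ SΓ ∪ SM ∪ Exc₁ ∪ Exc₂` a.e. ((6.8)–(6.9))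
  have hincl : ∀ᵐ B ∂μ, B ∈ A → B ∈ E ∨ B ∈ SΓ ∨ B ∈ SM ∨ B ∈ Exc₁ ∨ B ∈ Exc₂ := by
    filter_upwards [ae_pi_mem_Icc hτ.eq_zero hρ n] with β hβ hβA
    have hBk : ∀ k, finExt β k ∈ Set.Icc bm bp := finExt_mem_Icc hτ.bm_nonpos hτ.bp_nonneg hβ
    have hXA : ‖(ahPhase w (ahTheta w) (finExt β) n : UnitAddCircle)‖ ≤ w ^ 2 := hβA
    have hu1 : u (ahPhase w (ahTheta w) (finExt β) n) = 1 := rsWin_of_le hu hXA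
    by_cases hΓ : R < ahGamma w (ahTheta w) (finExt β) n
    · refine Or.inr (Or.inl ?_)
      show R ≤ u (ahPhase w (ahTheta w) (finExt β) n) * |ahGamma w (ahTheta w) (finExt β) n|
      rw [hu1, one_mul]
      exact hΓ.le.trans (le_abs_self _)
    have hΓ' : ahGamma w (ahTheta w) (finExt β) n ≤ R := not_lt.mp hΓ
    by_cases hM : R < Real.exp (ahMart w (finExt β) n)
    · refine Or.inr (Or.inr (Or.inl ?_))
      show R ≤ Real.exp (w * ∑ k ∈ Finset.range n,
        (fun y : ℝ => π * Real.sin (2 * π * y)) (ahPhase w (ahTheta w) (finExt β) k) * finExt β k) *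
        u (ahPhase w (ahTheta w) (finExt β) n)
      rw [hMart β, hu1, mul_one]
      exact hM.le
    have hM' : Real.exp (ahMart w (finExt β) n) ≤ R := not_lt.mp hM
    by_cases hd : c₀ * R * w < ahPhase w (ahTheta w) (finExt β) n - ahPhase w 0 (finExt β) n
    · exact Or.inr (Or.inr (Or.inr (Or.inl ⟨hM', hd⟩)))
    have hd' : ahPhase w (ahTheta w) (finExt β) n - ahPhase w 0 (finExt β) n ≤ c₀ * R * w := not_lt.mp hd
    by_cases hG : c₀ * ahGamma w (ahTheta w) (finExt β) n < ahGamma w 0 (finExt β) n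
    · exact Or.inr (Or.inr (Or.inr (Or.inr hG)))
    have hG' : ahGamma w 0 (finExt β) n ≤ c₀ * ahGamma w (ahTheta w) (finExt β) n := not_lt.mp hG
    refine Or.inl ⟨hXA, hΓ', ?_, ?_⟩
    · exact rs_norm_X0_le hw0.le hw1 hXA (hΘ w hww₅ (finExt β) hBk n).le hd'
    · calc ahGamma w 0 (finExt β) n ≤ c₀ * ahGamma w (ahTheta w) (finExt β) n := hG'
        _ ≤ c₀ * R := mul_le_mul_of_nonneg_left hΓ' hc₀.le
        _ = c₀ * R * 1 + 0 := by ring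
        _ ≤ c₀ * R * R + R := add_le_add (mul_le_mul_of_nonneg_left hR1 (by positivity)) hR0.le
        _ = (c₀ * R + 1) * R := by ring
  have hsplit := rs_measureReal_le_of_ae_imp₅ μ hincl
  -- (vi) assembly
  have hloss : μ.real SΓ + μ.real SM ≤ K₀' / 4 * w ^ 2 := by
    have h1 : μ.real SΓ + μ.real SM ≤ L * w ^ 2 / R := by
      calc μ.real SΓ + μ.real SM
          ≤ E₀ * K₂ * Real.sqrt 2 * (2 * w ^ 2) / R + K₁ * Real.sqrt 2 * (2 * w ^ 2) / R :=
            add_le_add hPΓ hPM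
        _ = L * w ^ 2 / R := by rw [hL]; ring
    have h2 : L * w ^ 2 / R ≤ K₀' / 4 * w ^ 2 := by
      rw [div_le_iff₀ hR0]
      have h3 : 4 * L ≤ R * K₀' := by
        have := hRL
        rwa [div_le_iff₀ hK₀'] at this
      have h4 : L ≤ R * K₀' / 4 := by linarith only [h3]
      calc L * w ^ 2 ≤ R * K₀' / 4 * w ^ 2 := mul_le_mul_of_nonneg_right h4 (sq_nonneg w)
        _ = K₀' / 4 * w ^ 2 * R := by ring
    exact h1.trans h2
  have hfin : K₀' * w ^ 2 - K₀' / 4 * w ^ 2 - K₀' / 8 * w ^ 2 - K₀' / 8 * w ^ 2 ≤ μ.real E := by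
    linarith only [hPA, hsplit, hloss, hP₁, hP₂]
  calc K₀' / 2 * w ^ 2 = K₀' * w ^ 2 - K₀' / 4 * w ^ 2 - K₀' / 8 * w ^ 2 - K₀' / 8 * w ^ 2 := by ring
    _ ≤ μ.real E := hfin

/-- **§6.1: `P(E_n) ≳ w²` on the critical band, from Prop. 5.1** —
`AjankiHuveneers2011_potentialTheory → AjankiHuveneers2011_resonantSetProbability`, the other two inputs
being theorems of the tree: Lemma 3.7 + Lemma 6.1 as (6.8)–(6.9)
(`AjankiHuveneers2011_jointBehaviourTails_holds`) and `X^ϑ_n - X^0_n > 0` ((3.25), `jb_theta_recursion`).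
"Proposition 5.1 and Lemma 6.1 allow then to conclude that `𝔼(j_n(w)) ≳ w²` if `R` is chosen large
enough." Composed with `AjankiHuveneers2011_criticalBandLowerBound_of_resonantSet` this is the whole of
§6.1 given Prop. 5.1.
[cite: AjankiHuveneers2011, §6.1, the two displays following (6.9), with Prop. 5.1 and Lemma 6.1] -/
theorem AjankiHuveneers2011_resonantSetProbability_of_potentialTheory
    (h5 : AjankiHuveneers2011_potentialTheory) : AjankiHuveneers2011_resonantSetProbability := by
  refine AjankiHuveneers2011_resonantSetProbability_of_inputs h5
    AjankiHuveneers2011_jointBehaviourTails_holds fun bm bp => ?_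
  obtain ⟨w₀, hw₀, -, C₃, -, hΘ⟩ := jb_theta_recursion bm bp
  exact ⟨w₀, hw₀, fun w hw B hB n => (hΘ w hw B hB).1 n⟩

/-- (L) from Prop. 5.1 alone: `AjankiHuveneers2011_potentialTheory → AjankiHuveneers2011_criticalBandLowerBound`
(`…_criticalBandLowerBound_of_resonantSet ∘ …_resonantSetProbability_of_potentialTheory`), i.e. §6.1 of the
paper is formalized up to its §5 input. [cite: AjankiHuveneers2011, §6.1] -/
theorem AjankiHuveneers2011_criticalBandLowerBound_of_potentialTheory
    (h5 : AjankiHuveneers2011_potentialTheory) : AjankiHuveneers2011_criticalBandLowerBound :=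
  AjankiHuveneers2011_criticalBandLowerBound_of_resonantSet
    (AjankiHuveneers2011_resonantSetProbability_of_potentialTheory h5)

end Literature.Barriers.AtomisticToContinuum

end
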